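import Literature.Geometry.Lorentzian.MaxAtlasChartKilling
import Literature.Geometry.Lorentzian.KillingOpensJetRigidity
import Literature.Geometry.Lorentzian.KillingAlgebraAsymptoticallyFlat
import Literature.Geometry.Lorentzian.LeviCivitaLocality
import Literature.Geometry.Lorentzian.LorentzianMetric
import HarnessLib

/-!
# G4 `stub_killingFieldOn_eqOn_of_isPreconnected` — Killing rigidity on a spacetime
# (brick for `stub_killingPropagation'`, K1a β', line `direct-method-on-the-cone`,
# crux `BondiBartnikRigidity`, stmt-FinalStateConjecture-10807)

**Manifold Killing rigidity** (O'Neill 1983, Ch. 9, Lemma 9.28 and Prop. 9.26 ff.; Kobayashi–Nomizu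
I, Ch. VI, Thm. 3.3 and Lemma 4 for Thm. 6.1): two Killing fields of a `C^∞` pseudo-Riemannian
metric on a (pre)connected open set `A` which agree on a non-empty open subset `W ⊆ A` agree on `A`.
PROVED here for any manifold modelled on a finite-dimensional real normed space `E` (boundaryless
model `𝓘(ℝ, E)`; `KillingRigidity.eqOn_of_eqOn_open`) and specialised to the tree's `Spacetime 4`
(model `𝓡 4 = 𝓘(ℝ, EuclideanSpace ℝ (Fin 4))`) as the registered brick
`stub_killingFieldOn_eqOn_of_isPreconnected` (signature verbatim).

Proof (open–closed argument on `D = {y | ξ₁ = ξ₂ near y}`; no completeness, no analyticity, no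
coordinate representatives):
* `KillingRigidity.exists_chart_source_subset` — every point `y` of an open `A` lies in the source
  of a chart `ψ` of the MAXIMAL `C^∞` atlas with `ψ.source ⊆ A` and `ψ.target` an open ball (the
  restriction of `chartAt y` to the preimage of a small chart ball, Mathlib's
  `restr_mem_maximalAtlas`), in particular preconnected;
* `KillingRigidity.eqOn_source_of_eventuallyEq` — for such a chart, two Killing fields on
  `ψ.source` agreeing near one point of the source agree on the source: transported along the
  inverse chart `Ψ = ψ⁻¹` they are GLOBAL Killing fields of `Ψ^* g` on the open submanifold
  `ψ.target ⊆ E` (`MaxAtlasChart.isKillingFieldOn_mpullback_inv`), their difference is a global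
  Killing field (`IsKillingField.sub`) vanishing near a point, hence with vanishing `1`-jet there
  (locality of `∇`, `leviCivita_congr_nhds`), hence zero by the one-jet rigidity of Killing fields on a
  preconnected chart (`IsKillingField.eq_zero_of_oneJet_eq_zero'` of `KillingOpensJetRigidity.lean`,
  the tree's form of O'Neill's Lemma 9.28 without completeness), and `Ψ`-related fields agree where their pullbacks do;
* `KillingRigidity.eqOn_of_eqOn_open` — `D` is open, non-empty (`W ⊆ D`) and relatively closed in
  `A` by the previous step, so `A ⊆ D` (`IsPreconnected.subset_of_closure_inter_subset`).

Everything is proved; no definitions, no named facts. References: [ONeillSemiRiemannian1983] Ch. 9,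
Prop. 9.25–9.26, Lemma 9.28; [KobayashiNomizu1963] Ch. VI, Thm. 3.3.
-/

noncomputable section

-- D-0017: single-problem summit, `Summit.<S>.<S>.…` by design (cf. lakefile `weak.linter.dupNamespace`).
set_option linter.dupNamespace false

open Set Filter Function TopologicalSpace Bundle VectorField
open Literature.Geometry.Lorentzian
open scoped Manifold ContDiff Topology

namespace Summit.FinalStateConjecture.FinalStateConjecture.Theorems.BondiBartnikRigidity.DirectMethod

namespace KillingRigidity

section Generic

variable {E : Type*} [NormedAddCommGroup E] [NormedSpace ℝ E]
  {X : Type*} [TopologicalSpace X] [ChartedSpace E X]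

/-- **Small charts of the maximal atlas with ball target.** Every point `y` of an open set `A` of a
`C^∞` manifold modelled on `E` lies in the source of a chart `ψ` of the maximal `C^∞` atlas with
`ψ.source ⊆ A` and preconnected target: restrict `chartAt y` to the preimage of a chart ball around
`chartAt y y` over `A` (Mathlib's `restr_mem_maximalAtlas`); the target of the restriction is that
ball. [folklore] -/
theorem exists_chart_source_subset [IsManifold 𝓘(ℝ, E) ∞ X] {A : Set X} (hA : IsOpen A) {y : X}
    (hy : y ∈ A) :
    ∃ ψ : OpenPartialHomeomorph X E, ψ ∈ IsManifold.maximalAtlas 𝓘(ℝ, E) ∞ X ∧ y ∈ ψ.source ∧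
      ψ.source ⊆ A ∧ IsPreconnected ψ.target := by
  set ψ₀ : OpenPartialHomeomorph X E := chartAt E y with hψ₀
  have hψ₀A : ψ₀ ∈ IsManifold.maximalAtlas 𝓘(ℝ, E) ∞ X := IsManifold.chart_mem_maximalAtlas y
  -- an open chart ball around `ψ₀ y` over `A`
  have hSo : IsOpen (ψ₀.target ∩ ψ₀.symm ⁻¹' A) :=
    ψ₀.continuousOn_symm.isOpen_inter_preimage ψ₀.open_target hA
  have hyS : ψ₀ y ∈ ψ₀.target ∩ ψ₀.symm ⁻¹' A := by
    refine ⟨mem_chart_target E y, ?_⟩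
    rw [mem_preimage, ψ₀.left_inv (mem_chart_source E y)]
    exact hy
  obtain ⟨r, hr, hrS⟩ := Metric.isOpen_iff.1 hSo _ hyS
  set s : Set X := ψ₀.source ∩ ψ₀ ⁻¹' Metric.ball (ψ₀ y) r with hs
  have hso : IsOpen s := ψ₀.isOpen_inter_preimage Metric.isOpen_ball
  refine ⟨ψ₀.restr s, restr_mem_maximalAtlas (contDiffGroupoid ∞ 𝓘(ℝ, E)) hψ₀A hso, ?_, ?_, ?_⟩
  · rw [ψ₀.restr_source' s hso]
    exact ⟨mem_chart_source E y, mem_chart_source E y, Metric.mem_ball_self hr⟩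
  · rw [ψ₀.restr_source' s hso]
    rintro x ⟨hx, -, hxb⟩
    have h := (hrS hxb).2
    rwa [mem_preimage, ψ₀.left_inv hx] at h
  · have htgt : (ψ₀.restr s).target = Metric.ball (ψ₀ y) r := by
      rw [OpenPartialHomeomorph.restr_target, hso.interior_eq]
      ext z
      constructor
      · rintro ⟨hz, -, hzb⟩
        rwa [mem_preimage, ψ₀.right_inv hz] at hzb
      · intro hzb
        have hzt : z ∈ ψ₀.target := (hrS hzb).1
        refine ⟨hzt, ψ₀.map_target hzt, ?_⟩
        rw [mem_preimage, ψ₀.right_inv hzt]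
        exact hzb
    rw [htgt]
    exact (convex_ball (ψ₀ y) r).isPreconnected

variable [FiniteDimensional ℝ E] [CompleteSpace E] [IsManifold 𝓘(ℝ, E) ∞ X]
  (g : PseudoRiemannianMetric 𝓘(ℝ, E) ∞ E (TangentSpace 𝓘(ℝ, E) : X → Type _)) [g.HasLeviCivita]

/-- **Killing fields agreeing near a point of a ball chart agree on the chart domain.** Let `ψ` be a
chart of the maximal `C^∞` atlas with preconnected target and `L`, `L'` Killing fields of `g` on
`ψ.source` with `L = L'` near a point `z ∈ ψ.source`. Then `L = L'` on `ψ.source`: the transported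
fields `Ψ^* L`, `Ψ^* L'` (`Ψ = ψ⁻¹`) are global Killing fields of `Ψ^* g` on the open submanifold
`ψ.target ⊆ E`, so `Z = Ψ^* L - Ψ^* L'` is a global Killing field vanishing near `ψ z`, whence
`Z(ψ z) = 0`, `∇Z(ψ z) = 0`, and `Z = 0` by one-jet rigidity on the preconnected target (O'Neill 1983,
Ch. 9, Lemma 9.28, in the completeness-free form `IsKillingField.eq_zero_of_oneJet_eq_zero'` of
`KillingOpensJetRigidity.lean`);
finally `L (Ψ p) = dΨ_p (Ψ^* L)(p)`. [cite: ONeillSemiRiemannian1983, Ch. 9, Lemma 9.28] -/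
theorem eqOn_source_of_eventuallyEq {ψ : OpenPartialHomeomorph X E}
    (hψ : ψ ∈ IsManifold.maximalAtlas 𝓘(ℝ, E) ∞ X) (hpc : IsPreconnected ψ.target)
    {L L' : Π x : X, TangentSpace 𝓘(ℝ, E) x} (hL : g.IsKillingFieldOn L ψ.source)
    (hL' : g.IsKillingFieldOn L' ψ.source) {z : X} (hz : z ∈ ψ.source) (hzL : L =ᶠ[𝓝 z] L') :
    ∀ x ∈ ψ.source, L x = L' x := by
  haveI := (MaxAtlasChart.metric g hψ).hasLeviCivita
  -- the transported fields are global Killing fields of `Ψ^* g`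
  have huniv : (MaxAtlasChart.inv ψ ⁻¹' ψ.source : Set (MaxAtlasChart.target ψ)) = univ :=
    eq_univ_of_forall fun p ↦ MaxAtlasChart.inv_mem_source p
  have hY : (MaxAtlasChart.metric g hψ).IsKillingField
      (mpullback 𝓘(ℝ, E) 𝓘(ℝ, E) (MaxAtlasChart.inv ψ) L) := by
    rw [← PseudoRiemannianMetric.isKillingFieldOn_univ, ← huniv]
    exact MaxAtlasChart.isKillingFieldOn_mpullback_inv g hψ ψ.open_source hL
  have hY' : (MaxAtlasChart.metric g hψ).IsKillingField
      (mpullback 𝓘(ℝ, E) 𝓘(ℝ, E) (MaxAtlasChart.inv ψ) L') := by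
    rw [← PseudoRiemannianMetric.isKillingFieldOn_univ, ← huniv]
    exact MaxAtlasChart.isKillingFieldOn_mpullback_inv g hψ ψ.open_source hL'
  have hZK : (MaxAtlasChart.metric g hψ).IsKillingField
      (mpullback 𝓘(ℝ, E) 𝓘(ℝ, E) (MaxAtlasChart.inv ψ) L -
        mpullback 𝓘(ℝ, E) 𝓘(ℝ, E) (MaxAtlasChart.inv ψ) L') := hY.sub hY'
  -- the difference vanishes near `p₀ = ψ z`
  set p₀ : MaxAtlasChart.target ψ := ⟨ψ z, ψ.map_source hz⟩ with hp₀
  have hp₀z : MaxAtlasChart.inv ψ p₀ = z := ψ.left_inv hz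
  have hcont : Continuous (MaxAtlasChart.inv ψ) := (MaxAtlasChart.contMDiff_inv' hψ).continuous
  have hev : (mpullback 𝓘(ℝ, E) 𝓘(ℝ, E) (MaxAtlasChart.inv ψ) L -
        mpullback 𝓘(ℝ, E) 𝓘(ℝ, E) (MaxAtlasChart.inv ψ) L') =ᶠ[𝓝 p₀]
      (0 : Π p : MaxAtlasChart.target ψ, TangentSpace 𝓘(ℝ, E) p) := by
    have h : {x | L x = L' x} ∈ 𝓝 (MaxAtlasChart.inv ψ p₀) := by
      rw [hp₀z]
      exact hzL
    filter_upwards [hcont.continuousAt.preimage_mem_nhds h] with p hp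
    have hp' : L (MaxAtlasChart.inv ψ p) = L' (MaxAtlasChart.inv ψ p) := hp
    show mpullback 𝓘(ℝ, E) 𝓘(ℝ, E) (MaxAtlasChart.inv ψ) L p -
        mpullback 𝓘(ℝ, E) 𝓘(ℝ, E) (MaxAtlasChart.inv ψ) L' p = 0
    rw [mpullback_apply, mpullback_apply, hp', sub_self]
  have h0 : (mpullback 𝓘(ℝ, E) 𝓘(ℝ, E) (MaxAtlasChart.inv ψ) L -
      mpullback 𝓘(ℝ, E) 𝓘(ℝ, E) (MaxAtlasChart.inv ψ) L') p₀ = 0 := hev.self_of_nhds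
  have h1 : ∀ v : E, (MaxAtlasChart.metric g hψ).leviCivita
      (mpullback 𝓘(ℝ, E) 𝓘(ℝ, E) (MaxAtlasChart.inv ψ) L -
        mpullback 𝓘(ℝ, E) 𝓘(ℝ, E) (MaxAtlasChart.inv ψ) L') p₀ v = 0 := fun v ↦ by
    rw [PseudoRiemannianMetric.leviCivita_congr_nhds _ hev,
      (MaxAtlasChart.metric g hψ).leviCivita.zero]
    rfl
  have hall := PseudoRiemannianMetric.IsKillingField.eq_zero_of_oneJet_eq_zero'
    (U := MaxAtlasChart.target ψ) hpc hZK h0 h1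
  -- back on `X`
  intro x hx
  obtain ⟨p, rfl⟩ := MaxAtlasChart.exists_inv_eq hx
  have hp : mpullback 𝓘(ℝ, E) 𝓘(ℝ, E) (MaxAtlasChart.inv ψ) L p -
      mpullback 𝓘(ℝ, E) 𝓘(ℝ, E) (MaxAtlasChart.inv ψ) L' p = 0 := hall p
  exact MaxAtlasChart.apply_inv_eq_of_mpullback_eq hψ (sub_eq_zero.1 hp)

/-- **Killing rigidity on a preconnected open set (manifold form, `C^∞` metric).** Two Killing
fields `L`, `L'` of `g` on a preconnected open set `A` which agree on a non-empty open `W ⊆ A` agree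
on `A`: the set `D = {y | L = L' near y}` is open, meets `A` (it contains `W`), and is relatively
closed in `A` — a point of `A` in the closure of `D` has a ball chart of the maximal atlas inside `A`
(`exists_chart_source_subset`) whose source meets `D`, so `L = L'` on that source
(`eqOn_source_of_eventuallyEq`) — hence `A ⊆ D`. O'Neill 1983, Ch. 9, Prop. 9.26 ff. and Lemma 9.28
(a Killing field on a connected manifold is determined by its `1`-jet at a point; here without
completeness); Kobayashi–Nomizu I, Ch. VI, Thm. 3.3 and Lemma 4 for Thm. 6.1.
[cite: ONeillSemiRiemannian1983, Ch. 9, Lemma 9.28] -/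
theorem eqOn_of_eqOn_open {A W : Set X} (hA : IsOpen A) (hAc : IsPreconnected A) (hW : IsOpen W)
    (hWA : W ⊆ A) (hWne : W.Nonempty) {L L' : Π x : X, TangentSpace 𝓘(ℝ, E) x}
    (hL : g.IsKillingFieldOn L A) (hL' : g.IsKillingFieldOn L' A) (hLW : ∀ y ∈ W, L y = L' y) :
    ∀ y ∈ A, L y = L' y := by
  let D : Set X := {y | L =ᶠ[𝓝 y] L'}
  have hDo : IsOpen D := isOpen_setOf_eventually_nhds
  obtain ⟨x, hxW⟩ := hWne
  have hxD : x ∈ D := Filter.eventually_of_mem (hW.mem_nhds hxW) hLW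
  have hsub : A ⊆ D := by
    refine hAc.subset_of_closure_inter_subset hDo ⟨x, hWA hxW, hxD⟩ ?_
    rintro y ⟨hyc, hyA⟩
    obtain ⟨ψ, hψ, hyψ, hψA, hpc⟩ := exists_chart_source_subset (E := E) hA hyA
    -- a point of `ψ.source` near which the fields agree
    obtain ⟨z, hzψ, hzD⟩ : (ψ.source ∩ D).Nonempty := by
      rw [mem_closure_iff_nhds] at hyc
      exact hyc _ (ψ.open_source.mem_nhds hyψ)
    have heq := eqOn_source_of_eventuallyEq g hψ hpc (hL.mono hψA) (hL'.mono hψA) hzψ hzD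
    exact Filter.eventually_of_mem (ψ.open_source.mem_nhds hyψ) heq
  intro y hy
  exact (hsub hy).eq_of_nhds

end Generic

end KillingRigidity

/-- **G4 — Killing rigidity on a spacetime (brick for `stub_killingPropagation'`, K1a β').** On a
four-dimensional spacetime `𝒮` (with the Levi-Civita connection of its `C^∞` metric), two Killing
fields `ξ₁`, `ξ₂` on a preconnected open set `A` (`IsKillingFieldOn`: `C^∞` on `A` and Killing
equation at the points of `A`) which agree on a non-empty open `W ⊆ A` agree on `A`
(`KillingRigidity.eqOn_of_eqOn_open` for the model `𝓡 4 = 𝓘(ℝ, EuclideanSpace ℝ (Fin 4))`).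
O'Neill 1983, Ch. 9, Prop. 9.26 ff. and Lemma 9.28; Kobayashi–Nomizu I, Ch. VI, Thm. 3.3.
[cite: ONeillSemiRiemannian1983, Ch. 9, Lemma 9.28] -/
theorem stub_killingFieldOn_eqOn_of_isPreconnected : ∀ (𝒮 : Spacetime.{0} 4) [𝒮.metric.toPseudoRiemannianMetric.HasLeviCivita] (A W : Set 𝒮.carrier) (ξ₁ ξ₂ : Π y : 𝒮.carrier, TangentSpace (𝓡 4) y), IsOpen A → IsPreconnected A → IsOpen W → W ⊆ A → W.Nonempty → 𝒮.metric.IsKillingFieldOn ξ₁ A → 𝒮.metric.IsKillingFieldOn ξ₂ A → (∀ y ∈ W, ξ₁ y = ξ₂ y) → ∀ y ∈ A, ξ₁ y = ξ₂ y :=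
  fun 𝒮 _ _ _ _ _ hA hAc hW hWA hWne h₁ h₂ hW₁₂ ↦
    KillingRigidity.eqOn_of_eqOn_open 𝒮.metric.toPseudoRiemannianMetric hA hAc hW hWA hWne h₁ h₂
      hW₁₂

end Summit.FinalStateConjecture.FinalStateConjecture.Theorems.BondiBartnikRigidity.DirectMethod

end
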